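import Literature.MathematicalPhysics.QuantumFieldTheory.Balaban1983to89.B15Prop1LinearisedKernelDictionary

/-!
# `Balaban1983to89.B15Prop1RightInverseFromForestLeftField` — [Balaban1985Variational] = «[15]», Sect. C (44)–(48) p. 285 («the right inverse (45)»), (82)–(83) p. 290;
# [Balaban1989LargeFieldII] (1.19) p. 360 («iΣ B^a σ_a»); [Balaban1985Averaging] (17), (21) p. 21:
# THE (45) LETTER `hR` OF THE w1 LINEAGE FROM A FOREST-SLICE LEFT-FIELD RIGHT INVERSE IN `𝔰𝔲(2)` CURRENCY — the coordinate dictionary `𝔰𝔲(2) = {Σ_a y_a E_a : y ∈ ℝ³}`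
# between dag-n12-w3's `N12ForestSliceLeftField` output (`p̂ : bonds → 𝔰𝔲(2)`, `p̂ = 0` on the tree) and `hMin_atRecord_of_node00Letters[_thm1AtBase]`'s binder
# (`p : bonds → ℝ³`, `cplxVec p ∈ S`, `S` the axial slice (F3) of the forest)

Honest framing: statement-level skeleton of published theorems with citation tags; proofs where landed; nothing here is a claim about the
Yang–Mills mass gap.  Cell `pub-ymgap`, HUMAN RULING D-0149 (width seats), seat `pub-ymgap-dag-n12-w1` (g3; N12 = [B15]; U1a⁺ of the w1 lineage, rule (ii)); `--kind proof
--supports` the K1 item of record; count-neutral; N12 NOT discharged; finite 𝕋⁴ at fixed ε; nothing continuum ∕ ℝ⁴ ∕ OS ∕ mass-gap ∕ Clay.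

CONTENTS (theorems only; no `def`, no `instance`, no `sorry`).  §1 `sum_smul_genE_mem_lieSU` (real combinations of the generators lie in `𝔰𝔲(2)`), `eq_of_sum_smul_genE_eq`
(coordinates are unique — the logarithmic coordinate functional `T(Σ y_a E_a) = y`), `exists_realCoords_of_lieSUField` (an `𝔰𝔲(2)`-valued bond field has real coordinates),
`cplxVec_mem_of_forall_path` (a real field vanishing on the path bonds has `cplxVec` in the (F3) slice).  §2 ★★ `hR_of_forest_leftField` (the (45) binder of
`B15Prop1LinearisedKernelDictionary.hMin_atRecord_of_node00Letters` ∕ `…_thm1AtBase` from a forest-slice left-field right inverse in `𝔰𝔲(2)` currency).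
HONEST SCOPE: linear algebra of `𝔰𝔲(2)`; the right inverse itself stays DISPLAYED (dag-n12-w3 ∕ dag-n10-w1 supply it); nothing of Bałaban's asserted; count-neutral; N12 NOT discharged;
the YM mass gap (Clay) is NOT proved by any of this — R4 closes only the conditional finite-𝕋⁴ rung `BalabanLadder.UV`.
-/

noncomputable section

namespace Literature.MathematicalPhysics.QuantumFieldTheory.Balaban1983to89.B15Prop1RightInverseFromForestLeftField

open Set Filter
open scoped Topology ComplexConjugate
open Literature.MathematicalPhysics.QuantumFieldTheory.Balaban1983to89.Node00 (SU coeField coeField_apply ConstrSet constrCard constrEnum dIterL)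
open T4AdjointCovarianceUnitary (lieSU mem_lieSU_iff)
open B15SU2ChartHolomorphic (genE genE_trace star_genE)
open B15Prop1LinearisedDatumCoordinates (exists_logCoordCLM)
open B15Prop1OntoFromRightInverse (logCoordCLM_genE_sum)
open B15Prop1LinearisedKernelDictionary (exists_coord_of_mem_lieSU_two)
open B15Prop1AnalyticExtClause (cplxVec)
open B15Prop1ChartCalculusSU2 (E3)
open T4CubeChartGnomonic (SU2)
open T4Continuum B15DeterminingSets GaugeField
open scoped Matrix.Norms.L2Operator

variable {P : Params}

/-! ## §1  The coordinate dictionary `𝔰𝔲(2) = {Σ_a y_a E_a : y ∈ ℝ³}` on bond fields -/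

/-- **REAL COMBINATIONS OF THE GENERATORS LIE IN `𝔰𝔲(2)`** (`E_a⋆ = −E_a`, `tr E_a = 0`). [cite: Balaban1989LargeFieldII, (1.19) p.360; Balaban1985Averaging, (17) p.21] -/
theorem sum_smul_genE_mem_lieSU (y : EuclideanSpace ℝ (Fin 3)) : (∑ a : Fin 3, ((y a : ℝ) : ℂ) • genE a) ∈ lieSU (Fin 2) := by
  rw [mem_lieSU_iff]
  constructor
  · rw [star_sum, ← Finset.sum_neg_distrib]
    refine Finset.sum_congr rfl fun a _ => ?_
    rw [star_smul, star_genE, Complex.star_def, Complex.conj_ofReal, smul_neg]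
  · rw [Matrix.trace_sum]
    refine Finset.sum_eq_zero fun a _ => ?_
    rw [Matrix.trace_smul, genE_trace, smul_zero]

/-- **COORDINATES ARE UNIQUE**: `Σ_a y_a E_a = Σ_a y′_a E_a` with real `y, y′` forces `y = y′` (apply the logarithmic coordinate functional `T`, `T(Σ y_a E_a) = y`).
[cite: Balaban1985Averaging, (21) p.21; Balaban1989LargeFieldII, (1.19) p.360] -/
theorem eq_of_sum_smul_genE_eq {y y' : EuclideanSpace ℝ (Fin 3)}
    (h : (∑ a : Fin 3, ((y a : ℝ) : ℂ) • genE a) = ∑ a : Fin 3, ((y' a : ℝ) : ℂ) • genE a) : y = y' := by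
  obtain ⟨T, hT⟩ := exists_logCoordCLM
  have hy := logCoordCLM_genE_sum hT (WithLp.toLp 2 fun a => ((y a : ℝ) : ℂ))
  have hy' := logCoordCLM_genE_sum hT (WithLp.toLp 2 fun a => ((y' a : ℝ) : ℂ))
  have hsum : (∑ b : Fin 3, (WithLp.toLp 2 fun a => ((y a : ℝ) : ℂ) : EuclideanSpace ℂ (Fin 3)) b • genE b) =
      ∑ b : Fin 3, (WithLp.toLp 2 fun a => ((y' a : ℝ) : ℂ) : EuclideanSpace ℂ (Fin 3)) b • genE b := by
    simpa using h
  rw [hsum] at hy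
  have hc := hy.symm.trans hy'
  ext a
  have := congrArg (fun v : EuclideanSpace ℂ (Fin 3) => (v a).re) hc
  simpa using this

/-- **AN `𝔰𝔲(2)`-VALUED BOND FIELD HAS REAL COORDINATES**: `∃ p : bonds → ℝ³`, `↑(q b) = Σ_a p_{b,a} E_a` for every bond. [cite: Balaban1989LargeFieldII, (1.19) p.360; Balaban1985Averaging, (17) p.21] -/
theorem exists_realCoords_of_lieSUField (q : PBond P 0 → lieSU (Fin 2)) :
    ∃ p : VecField P 0 E3, ∀ b, (∑ a : Fin 3, ((p b a : ℝ) : ℂ) • genE a) = ((q b : lieSU (Fin 2)) : Matrix (Fin 2) (Fin 2) ℂ) := by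
  choose f hf using fun b => exists_coord_of_mem_lieSU_two (q b).2
  exact ⟨fun b => f b, fun b => (hf b).symm⟩

/-- **A REAL FIELD VANISHING ON THE PATH BONDS HAS `cplxVec` IN THE (F3) SLICE.** [cite: Balaban1985RegularSpaces, (1.19) p.79 (bookkeeping)] -/
theorem cplxVec_mem_of_forall_path (S : Submodule ℂ (VecField P 0 (EuclideanSpace ℂ (Fin 3)))) (path : Site P 0 → List (LStep P 0))
    (hF3 : ∀ X : VecField P 0 (EuclideanSpace ℂ (Fin 3)), X ∈ S ↔ ∀ x, ∀ s ∈ path x, X s.bond = 0)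
    {p : VecField P 0 E3} (hp : ∀ x, ∀ s ∈ path x, p s.bond = 0) : cplxVec p ∈ S := by
  refine (hF3 _).2 fun x s hs => ?_
  ext a
  simp [cplxVec, hp x s hs]

/-! ## §2  The (45) letter `hR` from a forest-slice left-field right inverse -/

/-- ★★ **THE (45) BINDER OF THE w1 LINEAGE FROM A FOREST-SLICE LEFT-FIELD RIGHT INVERSE IN `𝔰𝔲(2)` CURRENCY.**  If for every `𝔰𝔲(2)`-valued target `y` on the constrained bonds there is an
`𝔰𝔲(2)`-valued bond field `q` VANISHING ON THE PATH BONDS of the forest with `Q_{j_i}(U₀)[b ↦ ↑q_b·↑U₀(b)](c_i) = ↑W_i·↑y_i` (dag-n12-w3's `N12ForestSliceLeftField` shape), then the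
binder `hR` of `hMin_atRecord_of_node00Letters[_thm1AtBase]` holds for the (F3) slice `S` of that forest: for every real target `τ : constraints → ℝ³` there is a real field `p` with
`cplxVec p ∈ S` and `Q_{j_i}(U₀)[b ↦ (Σ_a p_{b,a}E_a)·↑U₀(b)](c_i) = ↑W_i·Σ_b τ_{i,b}E_b`. [cite: Balaban1985Variational, Sect. C (44)–(48) p.285, (82)–(83) p.290; Balaban1989LargeFieldII, (1.19) p.360; Balaban1985Averaging, (17),(21) p.21] -/
theorem hR_of_forest_leftField (𝔹 : DetSet P) (k : ℕ) (W : MSField P SU2) (U₀ : GaugeField P 0 SU2)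
    (S : Submodule ℂ (VecField P 0 (EuclideanSpace ℂ (Fin 3)))) (path : Site P 0 → List (LStep P 0))
    (hF3 : ∀ X : VecField P 0 (EuclideanSpace ℂ (Fin 3)), X ∈ S ↔ ∀ x, ∀ s ∈ path x, X s.bond = 0)
    -- DISPLAYED: the forest-slice left-field right inverse of `Q(U₀)` in `𝔰𝔲(2)` currency
    (hL : ∀ y : Fin (constrCard 𝔹 k) → lieSU (Fin 2), ∃ q : PBond P 0 → lieSU (Fin 2), (∀ x, ∀ s ∈ path x, q s.bond = 0) ∧
      ∀ i : Fin (constrCard 𝔹 k), dIterL ((constrEnum 𝔹 k).symm i).1 (coeField U₀)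
        (fun b => ((q b : lieSU (Fin 2)) : Matrix (Fin 2) (Fin 2) ℂ) * ((U₀ b : SU2) : Matrix (Fin 2) (Fin 2) ℂ)) ((constrEnum 𝔹 k).symm i).2.1 =
        ((W ((constrEnum 𝔹 k).symm i).1 ((constrEnum 𝔹 k).symm i).2.1 : SU2) : Matrix (Fin 2) (Fin 2) ℂ) * ((y i : lieSU (Fin 2)) : Matrix (Fin 2) (Fin 2) ℂ)) :
    ∀ τ : Fin (constrCard 𝔹 k) → EuclideanSpace ℝ (Fin 3), ∃ p : VecField P 0 E3, cplxVec p ∈ S ∧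
      ∀ i : Fin (constrCard 𝔹 k), dIterL ((constrEnum 𝔹 k).symm i).1 (coeField U₀)
        (fun b => (∑ a : Fin 3, ((p b a : ℝ) : ℂ) • genE a) * ((U₀ b : SU2) : Matrix (Fin 2) (Fin 2) ℂ)) ((constrEnum 𝔹 k).symm i).2.1 =
        ((W ((constrEnum 𝔹 k).symm i).1 ((constrEnum 𝔹 k).symm i).2.1 : SU2) : Matrix (Fin 2) (Fin 2) ℂ) * ∑ b : Fin 3, ((τ i b : ℝ) : ℂ) • genE b := by
  intro τ
  obtain ⟨q, hq0, hq⟩ := hL fun i => ⟨∑ b : Fin 3, ((τ i b : ℝ) : ℂ) • genE b, sum_smul_genE_mem_lieSU (τ i)⟩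
  obtain ⟨p, hp⟩ := exists_realCoords_of_lieSUField q
  have hp0 : ∀ x, ∀ s ∈ path x, p s.bond = 0 := fun x s hs => by
    have h := hp s.bond
    rw [hq0 x s hs, Submodule.coe_zero] at h
    have h0 : (∑ a : Fin 3, (((0 : EuclideanSpace ℝ (Fin 3)) a : ℝ) : ℂ) • genE a) = 0 := by simp
    exact eq_of_sum_smul_genE_eq (h.trans h0.symm)
  refine ⟨p, cplxVec_mem_of_forall_path S path hF3 hp0, fun i => ?_⟩
  have hfun : (fun b => (∑ a : Fin 3, ((p b a : ℝ) : ℂ) • genE a) * ((U₀ b : SU2) : Matrix (Fin 2) (Fin 2) ℂ)) =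
      fun b => ((q b : lieSU (Fin 2)) : Matrix (Fin 2) (Fin 2) ℂ) * ((U₀ b : SU2) : Matrix (Fin 2) (Fin 2) ℂ) := funext fun b => by rw [hp b]
  rw [hfun, hq i]

end Literature.MathematicalPhysics.QuantumFieldTheory.Balaban1983to89.B15Prop1RightInverseFromForestLeftField

end
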